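import Mathlib
import Summits.Ventures.HodgeRepro2.T5LatticeBases

/-! # T5DifferentNorm — «disc(O_{E_v}) = N(𝔇) up to a unit» when the different is principal

Blind cell pub-hodge-repro2, seat p4 (Tier-5 kernel annex, README §7; record-class, cited by p-id
or ignored, never an input). README §8(d): uses an L-value-free non-vanishing device: NO.

The last prose link of (A13) (route/T5-route-2.md §N5.13.2, (iii-ramified)′): «`v_F(disc(O_{E_v}))
= v_F(N𝔇) = d(E_v/F_v)` as the residue degree is 1». In Mathlib's AKLB setting (`A ⊆ K`, `B ⊆ L`,
`B` the integral closure of `A` in the finite separable extension `L/K`, `B` a Dedekind domain —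
`A = O_{F_v}`, `B = O_{E_v}`) with `b` an `A`-basis of `B` and the different ideal PRINCIPAL,
`differentIdeal A B = span {x}` (every ideal of the discrete valuation ring `O_{E_v}` is):

* `norm_eq_unit_mul_discr` : `∃ u : Aˣ, Algebra.norm A x = u * Algebra.discr A b` —
  «`N_{E_v/F_v}(𝔇) = disc(O_{E_v})` as ideals of `O_{F_v}`»; and `val_norm_eq_val_discr` : for a
  valuation `v ≤ 1` on `A`, `v (norm A x) = v (discr A b)`.

Proof (all in the kernel): the inverse different `𝔇⁻¹ = x⁻¹ B` is the trace dual of `B`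
(`coeIdeal_differentIdeal`, `FractionalIdeal.coe_dual_one`), which is spanned over `A` by the
trace-dual basis `bK*` of the `K`-basis `bK = b ⊗ K` (`Submodule.traceDual_span_of_basis`); so the
two `A`-bases `bK*` and `x⁻¹ bK` of the lattice `𝔇⁻¹` differ by a matrix `P` over `A` with
`IsUnit P.det` (`T5LatticeBases.exists_isUnit_det_of_span_eq`, p394043); since
`bK = bK* · Gᵀ` with `G = traceMatrix b` (`Module.Basis.traceDual_repr_apply`),
`x · bK = bK · (P Gᵀ)`, i.e. the multiplication matrix of `x` in the basis `bK` is `P Gᵀ`; taking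
determinants, `N(x) = det P · det G = det P · disc b` (`Algebra.norm_eq_matrix_det`,
`Algebra.norm_localization`, `Algebra.discr_localizationLocalization`).

Stays prose for (A13): `v_F(N_{E_v/F_v}(π_E^d)) = d` at residue degree 1 (the local-field
dictionary for the norm of a uniformiser), and the local-field facts behind the AKLB hypotheses.
-/

namespace Summit.Ventures.HodgeRepro2.T5DifferentNorm

open Module Matrix Algebra
open Summit.Ventures.HodgeRepro2.T5LatticeBases
open scoped nonZeroDivisors

section Units

variable {A : Type*} [CommRing A]

/-- A valuation `≤ 1` on `A` is `1` on units (`v u * v u⁻¹ = 1` with both factors `≤ 1`). -/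
theorem val_eq_one_of_isUnit' {Γ₀ : Type*} [LinearOrderedCommGroupWithZero Γ₀]
    (v : Valuation A Γ₀) (hv : ∀ a : A, v a ≤ 1) {u : A} (hu : IsUnit u) : v u = 1 := by
  obtain ⟨w, hw⟩ := hu.exists_right_inv
  have h1 : v u * v w = 1 := by rw [← map_mul, hw, map_one]
  refine le_antisymm (hv u) ?_
  calc (1 : Γ₀) = v u * v w := h1.symm
    _ ≤ v u * 1 := mul_le_mul_right (hv w) _
    _ = v u := mul_one _

end Units

section Injective

variable (A K L B : Type*) [CommRing A] [Field K] [CommRing B] [Field L]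
  [Algebra A K] [Algebra B L] [Algebra A B] [Algebra K L] [Algebra A L]
  [IsScalarTower A K L] [IsScalarTower A B L] [IsFractionRing A K]

include K L in
/-- `algebraMap A B` is injective when `A → K → L` factors through `B` (`K = Frac A`). -/
theorem algebraMap_injective_AB : Function.Injective (algebraMap A B) := by
  intro a a' h
  have h' : algebraMap A L a = algebraMap A L a' := by
    rw [IsScalarTower.algebraMap_apply A B L, h, ← IsScalarTower.algebraMap_apply]
  rw [IsScalarTower.algebraMap_apply A K L, IsScalarTower.algebraMap_apply A K L a'] at h'
  exact IsFractionRing.injective A K ((algebraMap K L).injective h')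

/-- `A`-linear independence of a `K`-linearly independent family in `L`. -/
theorem linearIndependent_restrict {ι : Type*} {c : ι → L} (hc : LinearIndependent K c) :
    LinearIndependent A c := by
  refine hc.restrict_scalars ?_
  intro a a' h
  apply IsFractionRing.injective A K
  simpa only [Algebra.algebraMap_eq_smul_one] using h

omit [IsFractionRing A K] in
/-- `bK = bK* ᵥ* Gᵀ` with `G = traceMatrix K bK`: `bK j = ∑ i, trace (bK j * bK i) • bK* i`
(`Module.Basis.traceDual_repr_apply`). -/
theorem eq_vecMul_traceDual [FiniteDimensional K L] [Algebra.IsSeparable K L] {ι : Type*}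
    [Fintype ι] [DecidableEq ι] (bK : Basis ι K L) :
    ⇑bK = ⇑bK.traceDual ᵥ* (Algebra.traceMatrix K ⇑bK)ᵀ.map (algebraMap K L) := by
  ext j
  conv_lhs => rw [← bK.traceDual.sum_repr (bK j)]
  simp only [Matrix.vecMul, dotProduct, Matrix.map_apply, Matrix.transpose_apply,
    Basis.traceDual_repr_apply, Algebra.traceMatrix_apply]
  exact Finset.sum_congr rfl fun i _ => by rw [Algebra.smul_def, mul_comm]

omit [IsFractionRing A K] in
/-- `b.toMatrix (b ᵥ* N.map (algebraMap K L)) = N` for a `K`-basis `b` of `L`. -/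
theorem toMatrix_vecMul_map {ι : Type*} [Fintype ι] (bK : Basis ι K L) (N : Matrix ι ι K) :
    bK.toMatrix (⇑bK ᵥ* N.map (algebraMap K L)) = N := by
  ext i j
  rw [Basis.toMatrix_apply]
  have : (⇑bK ᵥ* N.map (algebraMap K L)) j = ∑ k, N k j • bK k := by
    simp only [Matrix.vecMul, dotProduct, Matrix.map_apply]
    exact Finset.sum_congr rfl fun k _ => by rw [Algebra.smul_def, mul_comm]
  rw [this]
  exact congrFun (bK.repr_sum_self fun k => N k j) i

end Injective

section BaseChange

variable (A K L B : Type*) [CommRing A] [Field K] [CommRing B] [Field L]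
  [Algebra A K] [Algebra B L] [Algebra A B] [Algebra K L] [Algebra A L]
  [IsScalarTower A K L] [IsScalarTower A B L]
  [IsFractionRing A K] [IsLocalization (Algebra.algebraMapSubmonoid B A⁰) L]
variable {ι : Type*}

/-- The `K`-basis `bK = b ⊗ K` of `L` induced by an `A`-basis `b` of `B`. -/
noncomputable abbrev baseChange (b : Basis ι A B) : Basis ι K L :=
  b.localizationLocalization K A⁰ L

/-- `bK i = b i` viewed in `L`. -/
theorem baseChange_apply (b : Basis ι A B) (i : ι) :
    baseChange A K L B b i = algebraMap B L (b i) :=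
  Basis.localizationLocalization_apply K A⁰ L b i

/-- `y * bK` is `K`-linearly independent for `y ≠ 0`. -/
theorem linearIndependent_mul_baseChange (b : Basis ι A B) {y : L} (hy : y ≠ 0) :
    LinearIndependent K fun i => y * baseChange A K L B b i :=
  (baseChange A K L B b).linearIndependent.map' (LinearMap.mulLeft K y)
    (LinearMap.ker_eq_bot.2 (mul_right_injective₀ hy))

variable [Fintype ι]

/-- For `y : L`, the `B`-span of `y` is spanned over `A` by the family `y * bK i`. -/
theorem restrictScalars_span_singleton_eq (b : Basis ι A B) (y : L) :
    (Submodule.span B {y}).restrictScalars A =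
      Submodule.span A (Set.range fun i => y * baseChange A K L B b i) := by
  let f : B →ₐ[A] L := IsScalarTower.toAlgHom A B L
  have hf : ∀ c : B, algebraMap B L c = f c := fun c => rfl
  have hsum : ∀ c : B, algebraMap B L c = ∑ i, b.repr c i • algebraMap B L (b i) := by
    intro c
    conv_lhs => rw [← b.sum_repr c]
    rw [hf, map_sum]
    exact Finset.sum_congr rfl fun i _ => by rw [map_smul, hf]
  ext z
  rw [Submodule.restrictScalars_mem, Submodule.mem_span_singleton,
    Submodule.mem_span_range_iff_exists_fun]
  constructor
  · rintro ⟨c, rfl⟩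
    refine ⟨fun i => b.repr c i, ?_⟩
    rw [Algebra.smul_def, hsum c, Finset.sum_mul]
    refine Finset.sum_congr rfl fun i _ => ?_
    rw [baseChange_apply, smul_mul_assoc, mul_comm]
  · rintro ⟨c, rfl⟩
    refine ⟨∑ i, c i • b i, ?_⟩
    rw [Algebra.smul_def, hf, map_sum, Finset.sum_mul]
    refine Finset.sum_congr rfl fun i _ => ?_
    rw [map_smul, baseChange_apply, hf, smul_mul_assoc, mul_comm]

/-- `B ⊂ L` is spanned over `A` by `bK`. -/
theorem one_restrictScalars_eq_span (b : Basis ι A B) :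
    (1 : Submodule B L).restrictScalars A =
      Submodule.span A (Set.range (baseChange A K L B b)) := by
  rw [Submodule.one_eq_span, restrictScalars_span_singleton_eq A K L B b 1]
  simp only [one_mul]

end BaseChange

section AKLB

variable (A K L B : Type*) [CommRing A] [Field K] [CommRing B] [Field L]
  [Algebra A K] [Algebra B L] [Algebra A B] [Algebra K L] [Algebra A L]
  [IsScalarTower A K L] [IsScalarTower A B L]
  [IsDomain A] [IsFractionRing A K] [FiniteDimensional K L] [Algebra.IsSeparable K L]
  [IsIntegralClosure B A L] [IsIntegrallyClosed A] [IsDedekindDomain B]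
  [Module.IsTorsionFree A B] [IsFractionRing B L]

omit [FiniteDimensional K L] [Algebra.IsSeparable K L] [IsIntegrallyClosed A]
  [Module.IsTorsionFree A B] in
include K in
/-- `L` is the localization of `B` at the non-zero elements of `A` (so that `bK` makes sense). -/
theorem isLocalization_algebraMapSubmonoid :
    IsLocalization (Algebra.algebraMapSubmonoid B A⁰) L := by
  haveI : FaithfulSMul A B :=
    (faithfulSMul_iff_algebraMap_injective A B).mpr (algebraMap_injective_AB A K L B)
  haveI : Algebra.IsIntegral A B := IsIntegralClosure.isIntegral_algebra A L
  haveI : Algebra.IsAlgebraic A B := inferInstance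
  infer_instance

variable {ι : Type*} [Fintype ι] [DecidableEq ι]

omit [IsDomain A] [IsFractionRing A K] [IsIntegralClosure B A L] [IsIntegrallyClosed A]
  [IsDedekindDomain B] [Module.IsTorsionFree A B] [IsFractionRing B L] in
/-- The trace dual of `B` is spanned over `A` by the trace-dual basis of `bK`. -/
theorem traceDual_one_eq_span_traceDual [IsFractionRing A K]
    [IsLocalization (Algebra.algebraMapSubmonoid B A⁰) L] (b : Basis ι A B) :
    (Submodule.traceDual A K (1 : Submodule B L)).restrictScalars A =
      Submodule.span A (Set.range (baseChange A K L B b).traceDual) :=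
  Submodule.traceDual_span_of_basis A (1 : Submodule B L) (baseChange A K L B b)
    (one_restrictScalars_eq_span A K L B b)

/-- If `differentIdeal A B = span {x}`, the trace dual of `B` is `x⁻¹ B`. -/
theorem traceDual_one_eq_span_inv (x : B) (hx : differentIdeal A B = Ideal.span {x}) :
    Submodule.traceDual A K (1 : Submodule B L) =
      Submodule.span B {(algebraMap B L x)⁻¹} := by
  have h := coeIdeal_differentIdeal A K L B
  rw [hx, FractionalIdeal.coeIdeal_span_singleton] at h
  have h' : FractionalIdeal.dual A K (1 : FractionalIdeal B⁰ L) =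
      FractionalIdeal.spanSingleton B⁰ (algebraMap B L x)⁻¹ := by
    rw [← FractionalIdeal.spanSingleton_inv, h, inv_inv]
  rw [← FractionalIdeal.coe_dual_one A K L B, h', FractionalIdeal.coe_spanSingleton]

variable [IsLocalization (Algebra.algebraMapSubmonoid B A⁰) L]

omit [DecidableEq ι] in
/-- Hence the trace dual of `B` is spanned over `A` by `x⁻¹ bK`. -/
theorem traceDual_one_eq_span_inv_mul (b : Basis ι A B) (x : B)
    (hx : differentIdeal A B = Ideal.span {x}) :
    (Submodule.traceDual A K (1 : Submodule B L)).restrictScalars A =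
      Submodule.span A (Set.range fun i => (algebraMap B L x)⁻¹ * baseChange A K L B b i) := by
  rw [traceDual_one_eq_span_inv A K L B x hx, restrictScalars_span_singleton_eq A K L B b]

/-- The two `A`-bases `bK*` and `x⁻¹ bK` of the inverse different differ by a matrix over `A`
with unit determinant. -/
theorem exists_isUnit_det_traceDual (b : Basis ι A B) (x : B)
    (hx : differentIdeal A B = Ideal.span {x}) (hx0 : x ≠ 0) :
    ∃ P : Matrix ι ι A, IsUnit P.det ∧ ∀ j, (baseChange A K L B b).traceDual j =
      ∑ i, P i j • ((algebraMap B L x)⁻¹ * baseChange A K L B b i) := by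
  have hx0' : algebraMap B L x ≠ 0 := fun h0 =>
    hx0 ((IsFractionRing.to_map_eq_zero_iff (K := L)).1 h0)
  refine exists_isUnit_det_of_span_eq
    (linearIndependent_restrict A K L (linearIndependent_mul_baseChange A K L B b
      (inv_ne_zero hx0')))
    (linearIndependent_restrict A K L (baseChange A K L B b).traceDual.linearIndependent) ?_
  rw [← traceDual_one_eq_span_traceDual A K L B b, traceDual_one_eq_span_inv_mul A K L B b x hx]

/-- The multiplication matrix of `x` in the basis `bK` is `P Gᵀ` with `G = traceMatrix A b` and
`P` the unit-determinant matrix of `exists_isUnit_det_traceDual`. -/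
theorem exists_leftMulMatrix_baseChange_eq (b : Basis ι A B) (x : B)
    (hx : differentIdeal A B = Ideal.span {x}) (hx0 : x ≠ 0) :
    ∃ P : Matrix ι ι A, IsUnit P.det ∧
      Algebra.leftMulMatrix (baseChange A K L B b) (algebraMap B L x) =
        (algebraMap A K).mapMatrix (P * (Algebra.traceMatrix A ⇑b)ᵀ) := by
  obtain ⟨P, hP, hPdual⟩ := exists_isUnit_det_traceDual A K L B b x hx hx0
  refine ⟨P, hP, ?_⟩
  have hx0' : algebraMap B L x ≠ 0 := fun h0 =>
    hx0 ((IsFractionRing.to_map_eq_zero_iff (K := L)).1 h0)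
  -- (1) `bK* = (x⁻¹ • bK) ᵥ* P`
  have h1 : ⇑(baseChange A K L B b).traceDual =
      ((algebraMap B L x)⁻¹ • ⇑(baseChange A K L B b)) ᵥ* P.map (algebraMap A L) := by
    ext j
    rw [hPdual j]
    simp only [Matrix.vecMul, dotProduct, Matrix.map_apply, Pi.smul_apply, smul_eq_mul]
    exact Finset.sum_congr rfl fun i _ => by rw [Algebra.smul_def, mul_comm]
  -- (2) `bK = bK* ᵥ* Gᵀ` and `G = traceMatrix A b` mapped to `K`
  have h2 := eq_vecMul_traceDual K L (baseChange A K L B b)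
  have h3 : Algebra.traceMatrix K ⇑(baseChange A K L B b) =
      (algebraMap A K).mapMatrix (Algebra.traceMatrix A ⇑b) :=
    Algebra.traceMatrix_localizationLocalization A A⁰ L b
  -- (3) the matrix `P Gᵀ` over `A`, mapped to `L` in one step or in two
  have h5 : P.map (algebraMap A L) *
      ((Algebra.traceMatrix A ⇑b).map (algebraMap A K))ᵀ.map (algebraMap K L) =
      ((algebraMap A K).mapMatrix (P * (Algebra.traceMatrix A ⇑b)ᵀ)).map (algebraMap K L) := by
    ext i j
    simp only [Matrix.mul_apply, Matrix.map_apply, Matrix.transpose_apply, RingHom.mapMatrix_apply,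
      map_sum, map_mul, IsScalarTower.algebraMap_apply A K L]
  -- (4) `x • bK = bK ᵥ* (P Gᵀ)`
  have h6 : algebraMap B L x • ⇑(baseChange A K L B b) = ⇑(baseChange A K L B b) ᵥ*
      ((algebraMap A K).mapMatrix (P * (Algebra.traceMatrix A ⇑b)ᵀ)).map (algebraMap K L) := by
    have h4 : ⇑(baseChange A K L B b) = ((algebraMap B L x)⁻¹ • ⇑(baseChange A K L B b)) ᵥ*
        (P.map (algebraMap A L) *
          (Algebra.traceMatrix K ⇑(baseChange A K L B b))ᵀ.map (algebraMap K L)) := by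
      conv_lhs => rw [h2, h1]
      rw [Matrix.vecMul_vecMul]
    rw [h3, RingHom.mapMatrix_apply, h5] at h4
    calc algebraMap B L x • ⇑(baseChange A K L B b)
        = algebraMap B L x • (((algebraMap B L x)⁻¹ • ⇑(baseChange A K L B b)) ᵥ*
            ((algebraMap A K).mapMatrix (P * (Algebra.traceMatrix A ⇑b)ᵀ)).map (algebraMap K L)) := by
          rw [← h4]
      _ = _ := by rw [Matrix.smul_vecMul, smul_smul, mul_inv_cancel₀ hx0', one_smul]
  -- (5) read off the multiplication matrix
  ext i j
  rw [Algebra.leftMulMatrix_eq_repr_mul]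
  have hj : algebraMap B L x * baseChange A K L B b j =
      (⇑(baseChange A K L B b) ᵥ*
        ((algebraMap A K).mapMatrix (P * (Algebra.traceMatrix A ⇑b)ᵀ)).map (algebraMap K L)) j := by
    have := congrFun h6 j
    simpa only [Pi.smul_apply, smul_eq_mul] using this
  rw [hj, ← Basis.toMatrix_apply, toMatrix_vecMul_map]

include K L in
/-- **«`disc(O_{E_v}) = N(𝔇)` up to a unit»**: in the AKLB setting with `b` an `A`-basis of `B`
and `differentIdeal A B = span {x}`, `x ≠ 0`, there is a unit `u` of `A` with
`Algebra.norm A x = u * Algebra.discr A b` (`Algebra.norm_eq_matrix_det`,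
`Algebra.norm_localization`, `exists_leftMulMatrix_baseChange_eq`). -/
theorem norm_eq_unit_mul_discr (b : Basis ι A B) (x : B)
    (hx : differentIdeal A B = Ideal.span {x}) (hx0 : x ≠ 0) :
    ∃ u : Aˣ, Algebra.norm A x = u * Algebra.discr A ⇑b := by
  obtain ⟨P, hP, hM⟩ := exists_leftMulMatrix_baseChange_eq A K L B b x hx hx0
  refine ⟨hP.unit, ?_⟩
  haveI : Module.Free A B := Module.Free.of_basis b
  haveI : Module.Finite A B := Module.Finite.of_basis b
  apply IsFractionRing.injective A K
  rw [← Algebra.norm_localization A A⁰ (Sₘ := L) x,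
    Algebra.norm_eq_matrix_det (baseChange A K L B b), hM, ← RingHom.map_det, Matrix.det_mul,
    Matrix.det_transpose, IsUnit.unit_spec, Algebra.discr_def]

include K L in
/-- «`v_F(N𝔇) = v_F(disc O_{E_v})`»: for a valuation `v ≤ 1` on `A` (`v = v_F` on `O_{F_v}`),
`v (norm A x) = v (discr A b)` when `differentIdeal A B = span {x}`. -/
theorem val_norm_eq_val_discr {Γ₀ : Type*} [LinearOrderedCommGroupWithZero Γ₀]
    (v : Valuation A Γ₀) (hv : ∀ a : A, v a ≤ 1) (b : Basis ι A B) (x : B)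
    (hx : differentIdeal A B = Ideal.span {x}) (hx0 : x ≠ 0) :
    v (Algebra.norm A x) = v (Algebra.discr A ⇑b) := by
  obtain ⟨u, hu⟩ := norm_eq_unit_mul_discr A K L B b x hx hx0
  rw [hu, map_mul, val_eq_one_of_isUnit' v hv u.isUnit, one_mul]

end AKLB

end Summit.Ventures.HodgeRepro2.T5DifferentNorm
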